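import Summits.QuantumFields.YangMills.Theorems.BalabanUVNodesN16KingModelTwoRun
import Literature.MathematicalPhysics.QuantumFieldTheory.King1986.CovarianceQstarDecay
import Literature.MathematicalPhysics.QuantumFieldTheory.Balaban1983to89.T4EtaRateMin

/-!
# Route «BalabanUVNodes» (K3⁶ `SpineGivenEndpointR13SepCoPR`, rev 22∕23), DAG node N16 = NE3 — THE KING-MODEL RUNG OF NE3 AT THE DECL LEVEL:
# the node's ABSTRACT ROOT DECL `T4EtaRateMin.NE3Shape R C θ` (YM-PLAN §2c row N16 «DECL `T4EtaRateMin.NE3Shape`») HOLDS, BOTH HALVES, for the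
# readings of King's `A = 0` block-spin minimisers — ACTION half = King's minimal block-spin energy `⟨φ, Δ^{(k)}φ⟩` (Lemma 4.3 ∕ Prop. 3.10 (3.91)),
# LOCAL half = the minimiser at the corner fine point over each unit site (Prop. 3.8 (3.71) line 1) — UNCONDITIONALLY, with the honest rate `0 < L^{−γ} < 1`

Cell `pub-ymgap`, seat `pub-ymgap-dag-n16-c` (R134 acceleration seat, strategy s1 «R2^ϱ, the unprinted core»; HUMAN RULING D-0062; chair R424 venue),
generation 9.  `--supports stmt-QuantumFields-20509 --as helper` (K3⁶, dag-lead WORDS-142, director-ym №179 KEY-22 SERVED).  `bears_on: R4∕N16`.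

WHY.  Generations 7–8 typed the King-model rung of NE3 (`BalabanUVNodesN16KingModelTwoRun` … `…TwoRunPattern`) as BARE INEQUALITIES; the programme's
consumers read node N16 through its abstract root `T4EtaRateMin.NE3Shape R C θ` over a `Readings` carrier (`BalabanUVNodesN14YoungRateLiaison.
argBracket_of_ne3Shape_gaugeDominated (Rd) (h3 : NE3Shape Rd C₃ θ₃)`, the N19 faces, `BalabanUVNodesN16HolderShape.ne3Shape_of_covRootHolder`), whose
hypothesis-free inhabitants in the tree are the toy `T4EtaRateMin.Witness.geom` and the FLAT-DATUM witnesses `dom = {flatCfg}` on Bałaban's carriers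
(`NE3ShapeCrudeWitness.ne3Shape_crude_sfClass_flat` &c.) — none over a non-trivial datum class.  As n15-e gave the cell's `LocalRate` King's COVARIANCE tower
(`BalabanUVNodesN15KingModelLimit.localRate_kingTower`), this file gives N16's own decl King's MINIMISERS, both readings FAITHFUL to the printed model:
SCALAR `act k φ := ⟨φ, Δ^{(k)}φ⟩ = min_ψ E^{(k)}_φ(ψ)`, King's MINIMAL block-spin ENERGY ((2.4)–(2.6)∕(2.14); `King1986.Torus.effLaplacian`,
`effLaplacian_eq_energy`) — the `A = 0` counterpart of the minimal action `A_k(V)` of reading (A); LOCAL `loc k φ y := ψ^{(k)}_φ(Lᵏ·y)`, King's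
MINIMISER ((2.13)∕(2.15); `King1986.Torus.minimiser`) at the CORNER fine point over the unit site `y` (p. 664 «we denote by x that point in T_η for
which x′ ∈ Bⁿ(x)»; the corner of level `k+1` lies over the corner of level `k`, `cornerFine_over`) — «a gauge-fixed component at corresponding
points»; both at levels `max k 1` (`a_k` (2.13) needs `k ≥ 1`; n15-e's device), every unit torus `Ω = Π ℤ∕M_μ`, odd `L ≥ 2`, `a, m² > 0`, data `|φ| ≤ S`.

WHAT THIS FILE PROVES (kernel; 2 data `def`s — `cornerFine`, `kingMinReadings` (a `Readings` TERM; no `Prop` is defined) —, 0 sorry; every estimate is a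
CITED tree theorem BY NAME: n18-b `king_prop38_torus` (Prop. 3.8 (3.71) line 1, torus, actual operators), n18-a `prop38Const_le_unif`, n15-e
`effLaplacian_sub_apply_le_torus` (Lemma 4.3 (4.18) in kernel form) + `thetaK_le`, g7 `minimiser_apply_eq_sum`):
* §1 `cornerFine`, `val_cornerFine`, `cornerFine_over`; SPELLING lemmas (`L¹·Lᵏ` vs `L^{k+1}`, `max k 1` vs `k`; by `subst`).
* §2 `abs_quadForm_sub_le`, `inv_sq_pow_le_rate_pow` (`L^{−2k} ≤ (L^{−γ})^k`, `γ ≤ 2`), ★ `abs_cornerMin_step_le` — `|ψ^{(k+1)}_φ(L^{k+1}y) − ψ^{(k)}_φ(Lᵏy)|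
  ≤ C₅(a,L,d,γ)·(L^{−γ})^k·Σ_b|φ(b)|` (`k ≥ 1`, `0 ≤ γ ≤ 1`), ★ `abs_minEnergy_step_le` — `|⟨φ,Δ^{(k+1)}φ⟩ − ⟨φ,Δ^{(k)}φ⟩| ≤ θ̄(a,L)·a·L^{−2k}·(Σ|φ|)²`.
* §3 ★ `localRate_kingMin` — `LocalRate (kingMinReadings L M a m² S) (C₅·|Ω|·S) (L^{−γ})`; ★ `actionRate_kingMin` — `ActionRate … (θ̄·a·|Ω|·S²) (L^{−γ})`
  (vol = `|Ω|`); ★★ **`ne3Shape_kingMin`** — `NE3Shape (kingMinReadings L M a m² S) (C₅|Ω|S + θ̄a|Ω|S²) (L^{−γ})`, `0 < γ ≤ 1`: THE NODE's DECL IN KING's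
  MODEL, hypothesis-free, HONEST rate `0 < L^{−γ} < 1` (`kingTheta_lt_one`).
* §4 read-backs through the decl's kernel API: `kingMin_loc_multiStep` (King's `n`-UNIFORM (3.71), `LocalRate.multiStep`), `kingMin_act_limit` (the minimal
  energies CONVERGE as `η = L^{−k} → 0` with the geometric tail — (3.92) — `ActionRate.exists_limit`).

ON «R2^ϱ» PROPER (header only).  `T4EtaRateMin.localRate_of_residual` names the road R1 (uniform response) ∘ R2 (= R2^ϱ: the block-averaged fine
minimiser's RESIDUAL in run A's system has geometric size — not in print).  King's road does NOT factor through it (Prop. 3.8 compares the kernels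
DIRECTLY via the Fourier representation (4.2)∕(4.19)); in King's model that residual is `A_k·(Q₁ψ^{(k+1)} − ψ^{(k)})` with `‖A_k‖ ~ L^{2k}` — no sup-norm
rate (census `pub-balaban-gaps/ne/NE3.md` §4 R8, OSC; g8: (3.71) prints no second derivative).  So King's model supplies the CONCLUSIONS `LocalRate` ∕
`ActionRate`, not R2^ϱ itself.  NOT CARRIED: gauge, covariant block average, Landau chart, the η-weighted energy currency and covariant Lipschitz∕Hölder
conjuncts of `NE3EnergyRateWCov` (g7∕g8 King templates), Bałaban's sharp axial constraint (King's is soft), volume-FREE constants (g7's ★★ has them on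
Bałaban's volumes for the block-mean form; here `C` carries `|Ω|` on an arbitrary volume).

HONEST FRAMING.  MODEL LAYER ([King1986] printed AND proved; re-proved in kernel BY NAME).  NOTHING of [Balaban1985RegularSpaces] ∕ [Balaban1985Variational]
is proved; N16 ∕ NE3 NOT discharged (in-edges N05 — [B8] Thm 4 ∕ Prop 3 at the pinned all-torus members — and N07 — [B11] Thm 1 (8)+(10) — remain
hypotheses of the chain of record); COUNT UNMOVED; one finite torus — NOT ℝ⁴ ∕ infinite volume ∕ OS ∕ mass gap ∕ Clay.  Locators [King1986] = C. King, CMP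
**102** (1986) 649–677: (2.4)–(2.6) p. 652, (2.13)–(2.15) p. 653, Thm 3.3 p. 655 ((3.6)–(3.7) p. 656), Prop. 3.8 (3.71) p. 664, Prop. 3.10 (3.91)–(3.92)
p. 669, Lemma 4.3 (4.18) p. 672, (4.35) p. 674.
-/

set_option autoImplicit false

noncomputable section

open Real Finset Filter Topology
open scoped BigOperators Matrix

namespace Summit.QuantumFields.YangMills.BalabanUVNodes.N16KingModelNE3Shape

open Literature.MathematicalPhysics.QuantumFieldTheory.Balaban1983to89.B5Prop11Plancherel (Tor fine)
open Literature.MathematicalPhysics.QuantumFieldTheory.Balaban1983to89.T4EtaRateMin (Readings ActionRate LocalRate NE3Shape)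
open Literature.MathematicalPhysics.QuantumFieldTheory.King1986 (aK prop38RateConst prop38PosConst thetaK)
open Literature.MathematicalPhysics.QuantumFieldTheory.King1986.Torus
  (minimiser effLaplacian thetaBar thetaK_le aminL_pos king_prop38_torus effLaplacian_sub_apply_le_torus)
open Summit.QuantumFields.YangMills.BalabanUVNodes.N18KingModel
  (prop38Const_le_unif prop38Const_unif_nonneg rpow_neg_natPow kingTheta_pos kingTheta_lt_one)
open Summit.QuantumFields.YangMills.BalabanUVNodes.N16KingModel (minimiser_apply_eq_sum)

variable {d : ℕ}

/-! ## §1 The corner fine point over a unit site, and the spelling `L¹·Lᵏ = L^{k+1}` -/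

/-- **THE CORNER FINE POINT** `N·y ∈ Tor (fine N M)` over the unit site `y ∈ Tor M` (coordinates `y_μ·N`): King's «x′ ∈ Bⁿ(x)» representative
(p. 664), the point at which the LOCAL reading evaluates the level-`N` minimiser.  A DATA definition. [cite: King1986, Prop. 3.8 p.664] -/
def cornerFine (N : ℕ) (M : Fin d → ℕ) (y : Tor M) : Tor (fine N M) :=
  fun μ => (((y μ).val * N : ℕ) : ZMod (fine N M μ))

/-- The coordinates of the corner: `(N·y)_μ = y_μ·N` (no wrap-around: `y_μ·N < N·M_μ`). [cite: King1986, Prop. 3.8 p.664] -/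
theorem val_cornerFine {N : ℕ} [NeZero N] (M : Fin d → ℕ) [∀ μ, NeZero (M μ)] (y : Tor M) (μ : Fin d) :
    (cornerFine N M y μ).val = (y μ).val * N := by
  have hN : 0 < N := Nat.pos_of_ne_zero (NeZero.ne N)
  have hlt : (y μ).val * N < fine N M μ := by
    have hy : (y μ).val < M μ := ZMod.val_lt (y μ)
    calc (y μ).val * N < M μ * N := Nat.mul_lt_mul_of_pos_right hy hN
      _ = N * M μ := by ring
  unfold cornerFine
  rw [ZMod.val_natCast, Nat.mod_eq_of_lt hlt]

/-- **The corner of level `LⁿLᵏ` lies OVER the corner of level `Lᵏ`** in n18-b's typing of «x′ ∈ Bⁿ(x)» (`x_μ = ⌊x′_μ∕Lⁿ⌋`):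
`y_μLᵏ = ⌊y_μLⁿLᵏ∕Lⁿ⌋`. [cite: King1986, Prop. 3.8 p.664] -/
theorem cornerFine_over {L : ℕ} [NeZero L] (k n : ℕ) (M : Fin d → ℕ) [∀ μ, NeZero (M μ)] (y : Tor M) :
    ∀ μ, (cornerFine (L ^ k) M y μ).val = (cornerFine (L ^ n * L ^ k) M y μ).val / L ^ n := by
  intro μ
  have hLn : 0 < L ^ n := pow_pos (Nat.pos_of_ne_zero (NeZero.ne L)) n
  rw [val_cornerFine, val_cornerFine]
  have h : (y μ).val * (L ^ n * L ^ k) = (y μ).val * L ^ k * L ^ n := by ring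
  rw [h, Nat.mul_div_cancel _ hLn]

/-- SPELLING (`L¹·Lᵏ` versus `L^{k+1}`, cf. `King1986.Torus.constrainedProp_congrN`): King's minimiser at the corner does not see how the fine
period `N` is spelled. [folklore] -/
theorem minimiser_cornerFine_congrN {N N' : ℕ} [NeZero N] [NeZero N'] (h : N = N') (M : Fin d → ℕ) [∀ μ, NeZero (M μ)]
    (a' m2 : ℝ) (φ : Tor M → ℝ) (y : Tor M) :
    minimiser N M a' (((N : ℕ) : ℝ) ^ 2) m2 φ (cornerFine N M y) = minimiser N' M a' (((N' : ℕ) : ℝ) ^ 2) m2 φ (cornerFine N' M y) := by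
  subst h
  rfl

/-- SPELLING for the quadratic form of the effective Laplacian. [folklore] -/
theorem quadForm_effLaplacian_congrN {N N' : ℕ} [NeZero N] [NeZero N'] (h : N = N') (M : Fin d → ℕ) [∀ μ, NeZero (M μ)]
    (a' m2 : ℝ) (φ : Tor M → ℝ) :
    φ ⬝ᵥ (effLaplacian N M a' (((N : ℕ) : ℝ) ^ 2) m2 *ᵥ φ) = φ ⬝ᵥ (effLaplacian N' M a' (((N' : ℕ) : ℝ) ^ 2) m2 *ᵥ φ) := by
  subst h
  rfl

/-- SPELLING of the LEVEL for the corner reading (`j = j′`). [folklore] -/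
theorem cornerMin_level_congr {L : ℕ} [NeZero L] {j j' : ℕ} (h : j = j') (M : Fin d → ℕ) [∀ μ, NeZero (M μ)] (a m2 : ℝ)
    (φ : Tor M → ℝ) (y : Tor M) :
    minimiser (L ^ j) M (aK a L j) (((L ^ j : ℕ) : ℝ) ^ 2) m2 φ (cornerFine (L ^ j) M y)
      = minimiser (L ^ j') M (aK a L j') (((L ^ j' : ℕ) : ℝ) ^ 2) m2 φ (cornerFine (L ^ j') M y) := by
  subst h
  rfl

/-- SPELLING of the LEVEL for the energy reading (`j = j′`). [folklore] -/
theorem minEnergy_level_congr {L : ℕ} [NeZero L] {j j' : ℕ} (h : j = j') (M : Fin d → ℕ) [∀ μ, NeZero (M μ)] (a m2 : ℝ)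
    (φ : Tor M → ℝ) :
    φ ⬝ᵥ (effLaplacian (L ^ j) M (aK a L j) (((L ^ j : ℕ) : ℝ) ^ 2) m2 *ᵥ φ)
      = φ ⬝ᵥ (effLaplacian (L ^ j') M (aK a L j') (((L ^ j' : ℕ) : ℝ) ^ 2) m2 *ᵥ φ) := by
  subst h
  rfl

/-! ## §2 The two one-step estimates: the minimiser at the corner (Prop. 3.8) and the minimal energy (Lemma 4.3 ∕ Prop. 3.10) -/

/-- If two real matrices differ entrywise by at most `t`, their quadratic forms at `φ` differ by at most `t·(Σ_z|φ z|)²`. [folklore] -/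
theorem abs_quadForm_sub_le {ι : Type*} [Fintype ι] (A B : Matrix ι ι ℝ) (φ : ι → ℝ) {t : ℝ}
    (h : ∀ z w, |A z w - B z w| ≤ t) : |φ ⬝ᵥ (A *ᵥ φ) - φ ⬝ᵥ (B *ᵥ φ)| ≤ t * (∑ z, |φ z|) ^ 2 := by
  rw [← dotProduct_sub, ← Matrix.sub_mulVec]
  simp only [dotProduct, Matrix.mulVec, Matrix.sub_apply]
  calc |∑ z, φ z * ∑ w, (A z w - B z w) * φ w| ≤ ∑ z, |φ z * ∑ w, (A z w - B z w) * φ w| := abs_sum_le_sum_abs _ _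
    _ ≤ ∑ z, |φ z| * (t * ∑ w, |φ w|) := by
        refine sum_le_sum fun z _ => ?_
        rw [abs_mul]
        refine mul_le_mul_of_nonneg_left ?_ (abs_nonneg _)
        calc |∑ w, (A z w - B z w) * φ w| ≤ ∑ w, |(A z w - B z w) * φ w| := abs_sum_le_sum_abs _ _
          _ ≤ ∑ w, t * |φ w| := sum_le_sum fun w _ => by
              rw [abs_mul]; exact mul_le_mul_of_nonneg_right (h z w) (abs_nonneg _)
          _ = t * ∑ w, |φ w| := by rw [mul_sum]
    _ = t * (∑ z, |φ z|) ^ 2 := by rw [← sum_mul, sq]; ring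

/-- `L^{−2k} ≤ (L^{−γ})^k` for `γ ≤ 2`, `L ≥ 1` (the energy half's rate `L⁻²` is at least as good as the local half's `L^{−γ}`). [folklore] -/
theorem inv_sq_pow_le_rate_pow {L : ℕ} (hL : 1 ≤ L) {γ : ℝ} (hγ : γ ≤ 2) (k : ℕ) :
    (((L : ℝ) ^ k) ^ 2)⁻¹ ≤ ((L : ℝ) ^ (-γ)) ^ k := by
  have hL0 : (0 : ℝ) ≤ (L : ℝ) ^ k := by positivity
  have h1 : (((L : ℝ) ^ k) ^ 2)⁻¹ = ((L : ℝ) ^ k) ^ (-(2 : ℝ)) := by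
    rw [Real.rpow_neg hL0, Real.rpow_two]
  have h2 : ((L : ℝ) ^ (-γ)) ^ k = ((L : ℝ) ^ k) ^ (-γ) := by
    rw [← rpow_neg_natPow]; push_cast; rfl
  rw [h1, h2]
  exact Real.rpow_le_rpow_of_exponent_le (one_le_pow₀ (by exact_mod_cast hL)) (by linarith)

section Steps

variable {L : ℕ} [NeZero L] (M : Fin d → ℕ) [∀ μ, NeZero (M μ)]

/-- ★ **THE LOCAL STEP: Prop. 3.8 (3.71) line 1 AT THE CORNER, applied to a datum** (odd `L ≥ 2`, `a, m² > 0`, `0 ≤ γ ≤ 1`, `k ≥ 1`, any volume):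
`|ψ^{(k+1)}_φ(L^{k+1}·y) − ψ^{(k)}_φ(Lᵏ·y)| ≤ C₅(a, L, d, γ)·(L^{−γ})^k·Σ_b|φ(b)|`, `C₅` = n18-a's uniform majorant of King's constant — `king_prop38_torus` at
`n = 1`, `x = Lᵏ·y`, `x′ = L¹Lᵏ·y` (`cornerFine_over`) + `prop38Const_le_unif` + `minimiser_apply_eq_sum`. [cite: King1986, Prop. 3.8 (3.71) p.664, (2.13)–(2.15) p.653] -/
theorem abs_cornerMin_step_le (hd : 0 < d) (hLodd : Odd L) (hL : 2 ≤ L) {a m2 : ℝ} (ha : 0 < a) (hm : 0 < m2) {γ : ℝ}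
    (hγ0 : 0 ≤ γ) (hγ1 : γ ≤ 1) {k : ℕ} (hk : 1 ≤ k) (φ : Tor M → ℝ) (y : Tor M) :
    |minimiser (L ^ (k + 1)) M (aK a L (k + 1)) (((L ^ (k + 1) : ℕ) : ℝ) ^ 2) m2 φ (cornerFine (L ^ (k + 1)) M y)
        - minimiser (L ^ k) M (aK a L k) (((L ^ k : ℕ) : ℝ) ^ 2) m2 φ (cornerFine (L ^ k) M y)|
      ≤ (prop38RateConst a a (a * (2 * ((a * (1 - ((L : ℝ) ^ 2)⁻¹))⁻¹ + π ^ 2 / 48 + 1 / 3))) ((π ^ 2 / 4) ^ d) d γ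
          + prop38PosConst a ((π ^ 2 / 4) ^ d) d γ) * ((L : ℝ) ^ (-γ)) ^ k * ∑ b, |φ b| := by
  have hN : L ^ 1 * L ^ k = L ^ (k + 1) := by ring
  rw [← minimiser_cornerFine_congrN hN M (aK a L (k + 1)) m2 φ y]
  set Cu : ℝ := prop38RateConst a a (a * (2 * ((a * (1 - ((L : ℝ) ^ 2)⁻¹))⁻¹ + π ^ 2 / 48 + 1 / 3))) ((π ^ 2 / 4) ^ d) d γ
    + prop38PosConst a ((π ^ 2 / 4) ^ d) d γ with hCu
  -- the per-kernel bound at the corner pair, constant majorised, rate rewritten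
  have hker : ∀ b : Tor M,
      |minimiser (L ^ 1 * L ^ k) M (aK a L (k + 1)) (((L ^ 1 * L ^ k : ℕ) : ℝ) ^ 2) m2 (Pi.single b 1) (cornerFine (L ^ 1 * L ^ k) M y)
          - minimiser (L ^ k) M (aK a L k) (((L ^ k : ℕ) : ℝ) ^ 2) m2 (Pi.single b 1) (cornerFine (L ^ k) M y)|
        ≤ Cu * ((L : ℝ) ^ (-γ)) ^ k := by
    intro b
    have h := king_prop38_torus hd hLodd hL hk (le_refl 1) M ha hm hγ0 hγ1 b (cornerFine (L ^ k) M y)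
      (cornerFine (L ^ 1 * L ^ k) M y) (cornerFine_over k 1 M y)
    refine h.trans ?_
    rw [rpow_neg_natPow]
    exact mul_le_mul_of_nonneg_right (prop38Const_le_unif hd ha hL hk (le_refl 1) (by linarith))
      (pow_nonneg (kingTheta_pos (by omega) γ).le k)
  -- expand both runs in the datum
  rw [minimiser_apply_eq_sum (L ^ 1 * L ^ k) M (aK a L (k + 1)) (((L ^ 1 * L ^ k : ℕ) : ℝ) ^ 2) m2 φ,
    minimiser_apply_eq_sum (L ^ k) M (aK a L k) (((L ^ k : ℕ) : ℝ) ^ 2) m2 φ, ← Finset.sum_sub_distrib]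
  calc |∑ b, (φ b * minimiser (L ^ 1 * L ^ k) M (aK a L (k + 1)) (((L ^ 1 * L ^ k : ℕ) : ℝ) ^ 2) m2 (Pi.single b 1)
            (cornerFine (L ^ 1 * L ^ k) M y)
          - φ b * minimiser (L ^ k) M (aK a L k) (((L ^ k : ℕ) : ℝ) ^ 2) m2 (Pi.single b 1) (cornerFine (L ^ k) M y))|
      ≤ ∑ b, |φ b * minimiser (L ^ 1 * L ^ k) M (aK a L (k + 1)) (((L ^ 1 * L ^ k : ℕ) : ℝ) ^ 2) m2 (Pi.single b 1)
            (cornerFine (L ^ 1 * L ^ k) M y)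
          - φ b * minimiser (L ^ k) M (aK a L k) (((L ^ k : ℕ) : ℝ) ^ 2) m2 (Pi.single b 1) (cornerFine (L ^ k) M y)| :=
        Finset.abs_sum_le_sum_abs _ _
    _ ≤ ∑ b, |φ b| * (Cu * ((L : ℝ) ^ (-γ)) ^ k) := by
        refine Finset.sum_le_sum fun b _ => ?_
        rw [← mul_sub, abs_mul]
        exact mul_le_mul_of_nonneg_left (hker b) (abs_nonneg _)
    _ = Cu * ((L : ℝ) ^ (-γ)) ^ k * ∑ b, |φ b| := by rw [← Finset.sum_mul, mul_comm]

/-- ★ **THE ENERGY STEP: Lemma 4.3 ∕ Prop. 3.10 (3.91) for the MINIMAL BLOCK-SPIN ENERGIES** (`L ≥ 2`, `a, m² > 0`, `k ≥ 1`, any volume):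
`|⟨φ, Δ^{(k+1)}φ⟩ − ⟨φ, Δ^{(k)}φ⟩| ≤ θ̄(a, L)·a·L^{−2k}·(Σ_z|φ(z)|)²` — `effLaplacian_sub_apply_le_torus` (`|Δ^{(k+1)}(z,w) − Δ^{(k)}(z,w)| ≤ θ_k·a`) + `thetaK_le`
through `abs_quadForm_sub_le`; `⟨φ, Δ^{(k)}φ⟩` is the minimal energy by `effLaplacian_eq_energy`. [cite: King1986, Lemma 4.3 (4.18) p.672, Prop. 3.10 (3.91) p.669, (2.14) p.653] -/
theorem abs_minEnergy_step_le (hL : 2 ≤ L) {a m2 : ℝ} (ha : 0 < a) (hm : 0 < m2) {k : ℕ} (hk : 1 ≤ k) (φ : Tor M → ℝ) :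
    |φ ⬝ᵥ (effLaplacian (L ^ (k + 1)) M (aK a L (k + 1)) (((L ^ (k + 1) : ℕ) : ℝ) ^ 2) m2 *ᵥ φ)
        - φ ⬝ᵥ (effLaplacian (L ^ k) M (aK a L k) (((L ^ k : ℕ) : ℝ) ^ 2) m2 *ᵥ φ)|
      ≤ thetaBar a L * a * (((L : ℝ) ^ k) ^ 2)⁻¹ * (∑ z, |φ z|) ^ 2 := by
  have hN : L ^ 1 * L ^ k = L ^ (k + 1) := by ring
  rw [← quadForm_effLaplacian_congrN hN M (aK a L (k + 1)) m2 φ]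
  refine (abs_quadForm_sub_le _ _ φ fun z w => effLaplacian_sub_apply_le_torus ha hm hL hk (le_refl 1) M z w).trans ?_
  have hθ := thetaK_le ha hL hk (le_refl 1) (a := a) (L := L) (k := k) (n := 1)
  have hS : 0 ≤ (∑ z, |φ z|) ^ 2 := sq_nonneg _
  calc thetaK a L k 1 * a * (∑ z, |φ z|) ^ 2 ≤ thetaBar a L * (((L : ℝ) ^ k) ^ 2)⁻¹ * a * (∑ z, |φ z|) ^ 2 :=
        mul_le_mul_of_nonneg_right (mul_le_mul_of_nonneg_right hθ ha.le) hS
    _ = thetaBar a L * a * (((L : ℝ) ^ k) ^ 2)⁻¹ * (∑ z, |φ z|) ^ 2 := by ring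

end Steps

/-! ## §3 King's readings and the node's decl `NE3Shape` in King's model -/

section ReadingsDef
variable (L : ℕ) [NeZero L] (M : Fin d → ℕ) [∀ μ, NeZero (M μ)]

/-- **KING's READINGS** (a term of the node's abstract carrier `T4EtaRateMin.Readings (Tor M → ℝ) (Tor M)`; a DATA definition): data `φ` on the unit
torus `Ω = Π ℤ∕M_μ` with `|φ| ≤ S`; SCALAR reading `act k φ = ⟨φ, Δ^{(k)}φ⟩` = King's minimal block-spin energy of `φ` after `k` steps (`effLaplacian`,
(2.4)–(2.6)∕(2.14)); LOCAL reading `loc k φ y = ψ^{(k)}_φ(Lᵏ·y)` = King's minimiser (2.13)∕(2.15) at the corner fine point over `y`; both at King's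
levels `max k 1` (`a_k` needs `k ≥ 1`, `c = η⁻² = (Lᵏ)²`, `a_k = aK a L k`); `vol = |Ω|`. [cite: King1986, (2.4)–(2.6) p.652, (2.13)–(2.15) p.653, Prop. 3.8 p.664] -/
def kingMinReadings (a m2 S : ℝ) : Readings (Tor M → ℝ) (Tor M) where
  dom := {φ | ∀ b, |φ b| ≤ S}
  act := fun k φ => φ ⬝ᵥ (effLaplacian (L ^ max k 1) M (aK a L (max k 1)) (((L ^ max k 1 : ℕ) : ℝ) ^ 2) m2 *ᵥ φ)
  loc := fun k φ y => minimiser (L ^ max k 1) M (aK a L (max k 1)) (((L ^ max k 1 : ℕ) : ℝ) ^ 2) m2 φ (cornerFine (L ^ max k 1) M y)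
  vol := Fintype.card (Tor M)
  vol_nonneg := Nat.cast_nonneg _

/-- The admissible data, unfolded. [folklore] -/
theorem mem_kingMinReadings_dom (a m2 S : ℝ) (φ : Tor M → ℝ) :
    φ ∈ (kingMinReadings L M a m2 S).dom ↔ ∀ b, |φ b| ≤ S := Iff.rfl

/-- The local reading, unfolded. [folklore] -/
theorem kingMinReadings_loc (a m2 S : ℝ) (k : ℕ) (φ : Tor M → ℝ) (y : Tor M) :
    (kingMinReadings L M a m2 S).loc k φ y
      = minimiser (L ^ max k 1) M (aK a L (max k 1)) (((L ^ max k 1 : ℕ) : ℝ) ^ 2) m2 φ (cornerFine (L ^ max k 1) M y) := rfl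

/-- The scalar reading, unfolded. [folklore] -/
theorem kingMinReadings_act (a m2 S : ℝ) (k : ℕ) (φ : Tor M → ℝ) :
    (kingMinReadings L M a m2 S).act k φ
      = φ ⬝ᵥ (effLaplacian (L ^ max k 1) M (aK a L (max k 1)) (((L ^ max k 1 : ℕ) : ℝ) ^ 2) m2 *ᵥ φ) := rfl

/-- The volume factor is `|Ω|`. [folklore] -/
theorem kingMinReadings_vol (a m2 S : ℝ) : (kingMinReadings L M a m2 S).vol = Fintype.card (Tor M) := rfl

end ReadingsDef

section Shape
variable {L : ℕ} [NeZero L] (M : Fin d → ℕ) [∀ μ, NeZero (M μ)]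

/-- Data of the admissible class have `Σ_b|φ(b)| ≤ |Ω|·S` and `S ≥ 0`. [folklore] -/
theorem sum_abs_le_of_mem_dom {a m2 S : ℝ} {φ : Tor M → ℝ} (hφ : φ ∈ (kingMinReadings L M a m2 S).dom) :
    ∑ b, |φ b| ≤ (Fintype.card (Tor M) : ℝ) * S ∧ 0 ≤ S := by
  rw [mem_kingMinReadings_dom] at hφ
  refine ⟨?_, (abs_nonneg _).trans (hφ 0)⟩
  calc ∑ b, |φ b| ≤ ∑ _b : Tor M, S := sum_le_sum fun b _ => hφ b
    _ = (Fintype.card (Tor M) : ℝ) * S := by rw [sum_const, nsmul_eq_mul, Finset.card_univ]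

/-- ★ **THE LOCAL HALF OF THE NODE's DECL IN KING's MODEL**: `LocalRate (kingMinReadings L M a m² S) (C₅·|Ω|·S) (L^{−γ})` for `d ≥ 1`, odd `L ≥ 2`,
`a, m² > 0`, `0 ≤ γ ≤ 1`, any volume and size — consecutive levels' minimisers at corresponding (corner) points differ by `≤ C₅|Ω|S·(L^{−γ})^k`
uniformly in the datum (`abs_cornerMin_step_le`; the `k = 0` step is `0` by the `max k 1` convention). [cite: King1986, Prop. 3.8 (3.71) p.664] -/
theorem localRate_kingMin (hd : 0 < d) (hLodd : Odd L) (hL : 2 ≤ L) {a m2 : ℝ} (ha : 0 < a) (hm : 0 < m2) {γ : ℝ}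
    (hγ0 : 0 ≤ γ) (hγ1 : γ ≤ 1) (S : ℝ) :
    LocalRate (kingMinReadings L M a m2 S)
      ((prop38RateConst a a (a * (2 * ((a * (1 - ((L : ℝ) ^ 2)⁻¹))⁻¹ + π ^ 2 / 48 + 1 / 3))) ((π ^ 2 / 4) ^ d) d γ
          + prop38PosConst a ((π ^ 2 / 4) ^ d) d γ) * (Fintype.card (Tor M) : ℝ) * S)
      ((L : ℝ) ^ (-γ)) := by
  set Cu : ℝ := prop38RateConst a a (a * (2 * ((a * (1 - ((L : ℝ) ^ 2)⁻¹))⁻¹ + π ^ 2 / 48 + 1 / 3))) ((π ^ 2 / 4) ^ d) d γ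
    + prop38PosConst a ((π ^ 2 / 4) ^ d) d γ with hCu
  have hCu0 : 0 ≤ Cu := prop38Const_unif_nonneg hd ha hL (by linarith)
  have hθ0 : 0 ≤ (L : ℝ) ^ (-γ) := (kingTheta_pos (by omega) γ).le
  intro k φ hφ y
  obtain ⟨hsum, hS0⟩ := sum_abs_le_of_mem_dom M hφ
  rw [kingMinReadings_loc, kingMinReadings_loc]
  rcases Nat.eq_zero_or_pos k with rfl | hk
  · -- both readings sit at King's level 1
    rw [cornerMin_level_congr (show max (0 + 1) 1 = max 0 1 by rfl) M a m2 φ y, sub_self, abs_zero]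
    positivity
  · have hk1 : 1 ≤ k := hk
    rw [cornerMin_level_congr (show max (k + 1) 1 = k + 1 from max_eq_left (by omega)) M a m2 φ y,
      cornerMin_level_congr (show max k 1 = k from max_eq_left hk1) M a m2 φ y]
    calc |minimiser (L ^ (k + 1)) M (aK a L (k + 1)) (((L ^ (k + 1) : ℕ) : ℝ) ^ 2) m2 φ (cornerFine (L ^ (k + 1)) M y)
            - minimiser (L ^ k) M (aK a L k) (((L ^ k : ℕ) : ℝ) ^ 2) m2 φ (cornerFine (L ^ k) M y)|
          ≤ Cu * ((L : ℝ) ^ (-γ)) ^ k * ∑ b, |φ b| := abs_cornerMin_step_le M hd hLodd hL ha hm hγ0 hγ1 hk1 φ y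
      _ ≤ Cu * ((L : ℝ) ^ (-γ)) ^ k * ((Fintype.card (Tor M) : ℝ) * S) :=
          mul_le_mul_of_nonneg_left hsum (mul_nonneg hCu0 (pow_nonneg hθ0 k))
      _ = Cu * (Fintype.card (Tor M) : ℝ) * S * ((L : ℝ) ^ (-γ)) ^ k := by ring

/-- ★ **THE ACTION HALF OF THE NODE's DECL IN KING's MODEL**: `ActionRate (kingMinReadings L M a m² S) (θ̄·a·|Ω|·S²) (L^{−γ})` for `L ≥ 2`,
`a, m² > 0`, `γ ≤ 2` — consecutive levels' MINIMAL ENERGIES differ by `≤ θ̄a|Ω|S²·(L^{−γ})^k·|Ω|` uniformly in the datum (`abs_minEnergy_step_le`;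
King's rate `L^{−2k}` weakened to `(L^{−γ})^k`, `inv_sq_pow_le_rate_pow`, so both halves share one `θ`). [cite: King1986, Lemma 4.3 (4.18) p.672, Prop. 3.10 (3.91) p.669] -/
theorem actionRate_kingMin (hL : 2 ≤ L) {a m2 : ℝ} (ha : 0 < a) (hm : 0 < m2) {γ : ℝ} (hγ2 : γ ≤ 2) (S : ℝ) :
    ActionRate (kingMinReadings L M a m2 S) (thetaBar a L * a * (Fintype.card (Tor M) : ℝ) * S ^ 2) ((L : ℝ) ^ (-γ)) := by
  have hθbar : 0 ≤ thetaBar a L := by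
    have := (inv_pos.2 (aminL_pos ha hL)).le
    unfold thetaBar
    positivity
  have hθ0 : 0 ≤ (L : ℝ) ^ (-γ) := (kingTheta_pos (by omega) γ).le
  intro k φ hφ
  obtain ⟨hsum, hS0⟩ := sum_abs_le_of_mem_dom M hφ
  rw [kingMinReadings_act, kingMinReadings_act, kingMinReadings_vol]
  have hV0 : (0 : ℝ) ≤ Fintype.card (Tor M) := Nat.cast_nonneg _
  rcases Nat.eq_zero_or_pos k with rfl | hk
  · rw [minEnergy_level_congr (show max (0 + 1) 1 = max 0 1 by rfl) M a m2 φ, sub_self, abs_zero]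
    positivity
  · have hk1 : 1 ≤ k := hk
    rw [minEnergy_level_congr (show max (k + 1) 1 = k + 1 from max_eq_left (by omega)) M a m2 φ,
      minEnergy_level_congr (show max k 1 = k from max_eq_left hk1) M a m2 φ]
    have hsq : (∑ z, |φ z|) ^ 2 ≤ ((Fintype.card (Tor M) : ℝ) * S) ^ 2 :=
      pow_le_pow_left₀ (sum_nonneg fun z _ => abs_nonneg _) hsum 2
    calc |φ ⬝ᵥ (effLaplacian (L ^ (k + 1)) M (aK a L (k + 1)) (((L ^ (k + 1) : ℕ) : ℝ) ^ 2) m2 *ᵥ φ)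
            - φ ⬝ᵥ (effLaplacian (L ^ k) M (aK a L k) (((L ^ k : ℕ) : ℝ) ^ 2) m2 *ᵥ φ)|
          ≤ thetaBar a L * a * (((L : ℝ) ^ k) ^ 2)⁻¹ * (∑ z, |φ z|) ^ 2 := abs_minEnergy_step_le M hL ha hm hk1 φ
      _ ≤ thetaBar a L * a * ((L : ℝ) ^ (-γ)) ^ k * (((Fintype.card (Tor M) : ℝ) * S) ^ 2) :=
          mul_le_mul (mul_le_mul_of_nonneg_left (inv_sq_pow_le_rate_pow (by omega) hγ2 k) (mul_nonneg hθbar ha.le)) hsq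
            (sq_nonneg _) (mul_nonneg (mul_nonneg hθbar ha.le) (pow_nonneg hθ0 k))
      _ = thetaBar a L * a * (Fintype.card (Tor M) : ℝ) * S ^ 2 * ((L : ℝ) ^ (-γ)) ^ k * (Fintype.card (Tor M) : ℝ) := by ring

/-- ★★ **THE NODE's ABSTRACT ROOT DECL `T4EtaRateMin.NE3Shape` HOLDS IN KING's MODEL, BOTH HALVES, UNCONDITIONALLY.**  For `d ≥ 1`, odd `L ≥ 2`,
`a, m² > 0`, `0 < γ ≤ 1`, every unit-torus volume `M` and data size `S`:
`NE3Shape (kingMinReadings L M a m² S) (C₅·|Ω|·S + θ̄·a·|Ω|·S²) (L^{−γ})` — HONEST rate `0 ≤ L^{−γ} < 1` (`kingTheta_lt_one`), halves `actionRate_kingMin` ∕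
`localRate_kingMin` (constants added so one `C` serves both): the η-rate mechanism N16 postulates for Bałaban's covariant constrained minimisers, as a
THEOREM for King's scalar ones, on the node's own decl. [cite: King1986, Prop. 3.8 (3.71) p.664, Prop. 3.10 (3.91)–(3.92) p.669, Lemma 4.3 (4.18) p.672] -/
theorem ne3Shape_kingMin (hd : 0 < d) (hLodd : Odd L) (hL : 2 ≤ L) {a m2 : ℝ} (ha : 0 < a) (hm : 0 < m2) {γ : ℝ}
    (hγ0 : 0 < γ) (hγ1 : γ ≤ 1) (S : ℝ) :
    NE3Shape (kingMinReadings L M a m2 S)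
      ((prop38RateConst a a (a * (2 * ((a * (1 - ((L : ℝ) ^ 2)⁻¹))⁻¹ + π ^ 2 / 48 + 1 / 3))) ((π ^ 2 / 4) ^ d) d γ
          + prop38PosConst a ((π ^ 2 / 4) ^ d) d γ) * (Fintype.card (Tor M) : ℝ) * S
        + thetaBar a L * a * (Fintype.card (Tor M) : ℝ) * S ^ 2)
      ((L : ℝ) ^ (-γ)) := by
  set Cu : ℝ := prop38RateConst a a (a * (2 * ((a * (1 - ((L : ℝ) ^ 2)⁻¹))⁻¹ + π ^ 2 / 48 + 1 / 3))) ((π ^ 2 / 4) ^ d) d γ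
    + prop38PosConst a ((π ^ 2 / 4) ^ d) d γ with hCu
  have hCu0 : 0 ≤ Cu := prop38Const_unif_nonneg hd ha hL (by linarith)
  have hθbar : 0 ≤ thetaBar a L := by
    have := (inv_pos.2 (aminL_pos ha hL)).le
    unfold thetaBar
    positivity
  have hθ0 : 0 ≤ (L : ℝ) ^ (-γ) := (kingTheta_pos (by omega) γ).le
  have hV0 : (0 : ℝ) ≤ Fintype.card (Tor M) := Nat.cast_nonneg _
  have hloc := localRate_kingMin M hd hLodd hL ha hm hγ0.le hγ1 S
  have hact := actionRate_kingMin M hL ha hm (show γ ≤ 2 by linarith) S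
  refine ⟨hθ0, kingTheta_lt_one hL hγ0, ?_, ?_⟩
  · -- action half: enlarge the constant by the (non-negative on the class) local constant
    intro k φ hφ
    obtain ⟨-, hS0⟩ := sum_abs_le_of_mem_dom M hφ
    refine (hact k φ hφ).trans ?_
    rw [kingMinReadings_vol]
    have h1 : 0 ≤ Cu * (Fintype.card (Tor M) : ℝ) * S := by positivity
    have h2 : 0 ≤ ((L : ℝ) ^ (-γ)) ^ k * (Fintype.card (Tor M) : ℝ) := by positivity
    nlinarith
  · -- local half: enlarge the constant by the (non-negative on the class) action constant
    intro k φ hφ y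
    obtain ⟨-, hS0⟩ := sum_abs_le_of_mem_dom M hφ
    refine (hloc k φ hφ y).trans ?_
    have h1 : 0 ≤ thetaBar a L * a * (Fintype.card (Tor M) : ℝ) * S ^ 2 := by positivity
    have h2 : 0 ≤ ((L : ℝ) ^ (-γ)) ^ k := by positivity
    nlinarith

/-! ## §4 Read-backs through the decl's kernel API: King's `n`-uniform form of (3.71) and the `η → 0` limit of the minimal energies -/

/-- **KING's `n`-UNIFORM FORM OF (3.71) AT THE CORNER, READ BACK FROM THE DECL** (`LocalRate.multiStep` on `localRate_kingMin`): for `0 < γ ≤ 1`,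
`|φ| ≤ S`: `|ψ^{(max (k+n) 1)}_φ(corner) − ψ^{(max k 1)}_φ(corner)| ≤ C₅|Ω|S·(L^{−γ})^k∕(1 − L^{−γ})`, constant INDEPENDENT of `n`. [cite: King1986, Prop. 3.8 (3.71) p.664] -/
theorem kingMin_loc_multiStep (hd : 0 < d) (hLodd : Odd L) (hL : 2 ≤ L) {a m2 : ℝ} (ha : 0 < a) (hm : 0 < m2) {γ : ℝ}
    (hγ0 : 0 < γ) (hγ1 : γ ≤ 1) {S : ℝ} {φ : Tor M → ℝ} (hφ : ∀ b, |φ b| ≤ S) (y : Tor M) (k n : ℕ) :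
    |(kingMinReadings L M a m2 S).loc (k + n) φ y - (kingMinReadings L M a m2 S).loc k φ y|
      ≤ (prop38RateConst a a (a * (2 * ((a * (1 - ((L : ℝ) ^ 2)⁻¹))⁻¹ + π ^ 2 / 48 + 1 / 3))) ((π ^ 2 / 4) ^ d) d γ
          + prop38PosConst a ((π ^ 2 / 4) ^ d) d γ) * (Fintype.card (Tor M) : ℝ) * S
        * ((L : ℝ) ^ (-γ)) ^ k / (1 - (L : ℝ) ^ (-γ)) :=
  (localRate_kingMin M hd hLodd hL ha hm hγ0.le hγ1 S).multiStep (kingTheta_pos (by omega) γ).le (kingTheta_lt_one hL hγ0)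
    ((mem_kingMinReadings_dom L M a m2 S φ).2 hφ) y k n

/-- **THE MINIMAL BLOCK-SPIN ENERGIES CONVERGE AS `η = L^{−k} → 0`, WITH THE GEOMETRIC TAIL** (`ActionRate.exists_limit` on `actionRate_kingMin` at
King's own rate `L⁻²`): `⟨φ, Δ^{(max k 1)}φ⟩ → E` with `|⟨φ, Δ^{(max k 1)}φ⟩ − E| ≤ θ̄a|Ω|S²·|Ω|·(L⁻²)^k∕(1 − L⁻²)` — (3.92) «the `L^{−2k}`-convergence of
the quadratic form» in the cell's reading-(A) currency. [cite: King1986, Prop. 3.10 (3.91)–(3.92) p.669] -/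
theorem kingMin_act_limit (hL : 2 ≤ L) {a m2 : ℝ} (ha : 0 < a) (hm : 0 < m2) {S : ℝ} {φ : Tor M → ℝ} (hφ : ∀ b, |φ b| ≤ S) :
    ∃ E : ℝ, Tendsto (fun k => (kingMinReadings L M a m2 S).act k φ) atTop (𝓝 E) ∧
      ∀ k, |(kingMinReadings L M a m2 S).act k φ - E|
        ≤ thetaBar a L * a * (Fintype.card (Tor M) : ℝ) * S ^ 2 * (Fintype.card (Tor M) : ℝ)
            * ((L : ℝ) ^ (-(2 : ℝ))) ^ k / (1 - (L : ℝ) ^ (-(2 : ℝ))) := by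
  have h := (actionRate_kingMin M hL ha hm (le_refl (2 : ℝ)) S).exists_limit (kingTheta_lt_one hL two_pos)
    ((mem_kingMinReadings_dom L M a m2 S φ).2 hφ)
  simpa only [kingMinReadings_vol] using h

end Shape

end Summit.QuantumFields.YangMills.BalabanUVNodes.N16KingModelNE3Shape

end
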